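import Literature.NumberTheory.EllipticCurves.ZpExtensionEisensteinPiRefinement
import HarnessLib

/-!
# The two-index torsion transitions `E[p^{k'}] → E[p^k]` and the `π`-adic refinement datum of the curve's
# Eisenstein tower (definitions with bodies + proved lemmas; no named fact, no instance, no `sorry`)

Topic `NumberTheory/EllipticCurves` (D1 road of cell `pub/bsd-print-x9`; companion of `ZpExtensionEisensteinPiRefinement`
(the datum for a functorial module tower) and `ZpExtensionEisensteinDVRSetting` (Howard's §1.6 data for the curve, whose
tower `W.eisensteinTower κ hm` is the SHIFTED Eisenstein tower along the one-step transitions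
`torsionGaloisModuleReduce`)).

B. Howard, Compositio Math. 140 (2004), §2.2 / proof of Thm. 2.2.10: `T_𝔮 = T_p E ⊗ S_𝔮 = lim_k E[p^k] ⊗ A_{m,k}(ψ)`
along multiplication by `p`.  The `π`-adic refinement (`Howard2004.PiRefinementDatum`) wants the transitions as a
FUNCTORIAL two-index family; this file supplies it for `E`:

* `WeierstrassCurve.geomTorsionReduceLE p (h : k ≤ k') : E[p^{k'}] →+ E[p^k]`, `P ↦ p^{k'-k} • P`, packaged
  `→ⁱL` as `torsionGaloisModuleReduceLE` (refl / trans / surjective / kernel `p^k · E[p^{k'}]`;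
  `torsionGaloisModuleReduceLE_succ : … (Nat.le_succ k) = torsionGaloisModuleReduce p k`);
* **`WeierstrassCurve.eisensteinPiRefinementDatum E κ hm`** — the datum of `ZpExtension.eisensteinPiRefinementDatum`
  for `M_k = E[p^k]` (freeness of the levels over `A_{m,k}`: tree `free_twisted_geomTorsion`), for an elliptic curve
  `E` over a number field `K`;
* bridge to the §1.6 assembly: `eisensteinPiRefinementDatum_red_succ` — the datum's one-step reductions ARE the
  reductions of `eisensteinAdicTowerSucc`/`W.eisensteinTower` (same `eisensteinTwistReduce`, `torsionGaloisModuleReduceLE_succ`).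

Nothing about Selmer groups is asserted; BSD is not proved by any of this.

References: [Howard2004HeegnerKolyvagin] §1.6, §2.2, proof of Thm. 2.2.10; [SilvermanAEC2009] III.§7, VIII.§2
(`0 → E[m] → E(K̄) → E(K̄) → 0`), Cor. III.6.4(b).
-/

set_option autoImplicit false

noncomputable section

open scoped TensorProduct ContRepresentation Pointwise
open Field Function

/-! ## §1 The two-index transitions `E[p^{k'}] → E[p^k]`, `P ↦ p^{k'-k} P` -/

namespace WeierstrassCurve

open Literature.NumberTheory.EllipticCurves Literature.NumberTheory.GaloisRepresentations

variable {F : Type} [Field F] (W : WeierstrassCurve F) (p : ℕ)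

/-- **`E[p^{k'}] → E[p^k]`, `P ↦ p^{k'-k} • P`** (`k ≤ k'`), the functorial two-index form of the tree's
`geomTorsionReduce` (`k' = k+1`). [cite: SilvermanAEC2009, III.§7 (the Tate module T_p E = lim E[p^k])] -/
def geomTorsionReduceLE {k k' : ℕ} (h : k ≤ k') : geomTorsion W ((p : ℤ) ^ k') →+ geomTorsion W ((p : ℤ) ^ k) :=
  ((zsmulAddGroupHom (α := geomPoints W) ((p : ℤ) ^ (k' - k))).comp
    (geomTorsion W ((p : ℤ) ^ k')).subtype).codRestrict (geomTorsion W ((p : ℤ) ^ k)) fun P ↦ by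
      rw [mem_geomTorsion_iff, AddMonoidHom.coe_comp, Function.comp_apply, AddSubgroup.coe_subtype,
        zsmulAddGroupHom_apply, smul_smul, ← pow_add, Nat.add_sub_cancel' h, ← mem_geomTorsion_iff]
      exact P.2

/-- Values of `geomTorsionReduceLE`. [cite: SilvermanAEC2009, III.§7] -/
@[simp]
theorem coe_geomTorsionReduceLE {k k' : ℕ} (h : k ≤ k') (P : geomTorsion W ((p : ℤ) ^ k')) :
    ((W.geomTorsionReduceLE p h P : geomTorsion W ((p : ℤ) ^ k)) : geomPoints W) =
      (p : ℤ) ^ (k' - k) • (P : geomPoints W) :=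
  rfl

/-- **`P ↦ p^{k'-k} • P` as a continuous `Γ_F`-intertwining map** `E[p^{k'}] → E[p^k]` of the discrete Galois modules
`torsionGaloisModule`. [cite: SilvermanAEC2009, III.§7 (Γ acts on T_p E compatibly with [p])] -/
def torsionGaloisModuleReduceLE {k k' : ℕ} (h : k ≤ k') :
    (W.torsionGaloisModule ((p : ℤ) ^ k')).toContRepresentation →ⁱL
      (W.torsionGaloisModule ((p : ℤ) ^ k)).toContRepresentation where
  toContinuousLinearMap := ⟨(W.geomTorsionReduceLE p h).toIntLinearMap, continuous_of_discreteTopology⟩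
  isIntertwining' σ := by
    ext P
    change (p : ℤ) ^ (k' - k) • ((σ • P : geomTorsion W ((p : ℤ) ^ k')) : geomPoints W) =
      σ • ((p : ℤ) ^ (k' - k) • (P : geomPoints W))
    rw [Literature.NumberTheory.EllipticCurves.AddSubgroup.torsionBy.coe_smul, smul_zsmul_geomPoints]

/-- On underlying points `torsionGaloisModuleReduceLE h` is `P ↦ p^{k'-k} • P`. [cite: SilvermanAEC2009, III.§7] -/
theorem coe_torsionGaloisModuleReduceLE {k k' : ℕ} (h : k ≤ k') (P : geomTorsion W ((p : ℤ) ^ k')) :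
    ((W.torsionGaloisModuleReduceLE p h P : geomTorsion W ((p : ℤ) ^ k)) : geomPoints W) =
      (p : ℤ) ^ (k' - k) • (P : geomPoints W) :=
  rfl

/-- Functoriality: the transition `E[p^k] → E[p^k]` is the identity. [cite: SilvermanAEC2009, III.§7] -/
theorem torsionGaloisModuleReduceLE_refl (k : ℕ) (P : geomTorsion W ((p : ℤ) ^ k)) :
    W.torsionGaloisModuleReduceLE p (le_refl k) P = P := by
  apply Subtype.ext
  rw [coe_torsionGaloisModuleReduceLE, Nat.sub_self, pow_zero, one_smul]

/-- Functoriality: the transitions compose. [cite: SilvermanAEC2009, III.§7] -/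
theorem torsionGaloisModuleReduceLE_trans {a b c : ℕ} (h₁ : a ≤ b) (h₂ : b ≤ c) (P : geomTorsion W ((p : ℤ) ^ c)) :
    W.torsionGaloisModuleReduceLE p (h₁.trans h₂) P =
      W.torsionGaloisModuleReduceLE p h₁ (W.torsionGaloisModuleReduceLE p h₂ P) := by
  apply Subtype.ext
  rw [coe_torsionGaloisModuleReduceLE, coe_torsionGaloisModuleReduceLE, coe_torsionGaloisModuleReduceLE, smul_smul,
    ← pow_add, show b - a + (c - b) = c - a by omega]

/-- The one-step transition is the tree's `torsionGaloisModuleReduce` (`P ↦ p • P`). [cite: SilvermanAEC2009, III.§7] -/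
theorem torsionGaloisModuleReduceLE_succ (k : ℕ) :
    W.torsionGaloisModuleReduceLE p (Nat.le_succ k) = W.torsionGaloisModuleReduce p k := by
  apply DFunLike.ext
  intro P
  apply Subtype.ext
  rw [coe_torsionGaloisModuleReduceLE, coe_torsionGaloisModuleReduce, show k + 1 - k = 1 by omega, pow_one]

variable [W.IsElliptic] [hp : Fact p.Prime]

/-- **`P ↦ p^{k'-k} • P` is onto `E[p^k]`** over `F̄` (`E(F̄)` is divisible, tree `zsmul_geomPoints_surjective_holds`).
[cite: SilvermanAEC2009, VIII.§2 (0 → E[m] → E(K̄) → E(K̄) → 0)] -/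
theorem torsionGaloisModuleReduceLE_surjective {k k' : ℕ} (h : k ≤ k') :
    Surjective (W.torsionGaloisModuleReduceLE p h) := by
  intro R
  obtain ⟨Q₀, hQ₀⟩ := W.zsmul_geomPoints_surjective_holds (n := (p : ℤ) ^ (k' - k))
    (pow_ne_zero _ (by exact_mod_cast hp.out.ne_zero)) (R : geomPoints W)
  change (p : ℤ) ^ (k' - k) • Q₀ = (R : geomPoints W) at hQ₀
  have hpow : ((p : ℤ) ^ k') = (p : ℤ) ^ k * (p : ℤ) ^ (k' - k) := by
    rw [← pow_add, Nat.add_sub_cancel' h]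
  have hQ₀mem : Q₀ ∈ geomTorsion W ((p : ℤ) ^ k') := by
    rw [mem_geomTorsion_iff, hpow, ← smul_smul, hQ₀]
    exact (mem_geomTorsion_iff W _ _).mp R.2
  exact ⟨⟨Q₀, hQ₀mem⟩, Subtype.ext hQ₀⟩

/-- **The kernel of `P ↦ p^{k'-k} • P` on `E[p^{k'}]` is `p^k · E[p^{k'}]`** (divisibility of `E(F̄)`): the exactness
input `hkt` of `ZpExtension.eisensteinPiRefinementDatum` / `ker_eisensteinTwistReduceLinear` for `M_k = E[p^k]`.
[cite: SilvermanAEC2009, VIII.§2 (0 → E[m] → E(K̄) → E(K̄) → 0), Cor. III.6.4(b)] -/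
theorem torsionGaloisModuleReduceLE_eq_zero_iff {k k' : ℕ} (h : k ≤ k') (P : geomTorsion W ((p : ℤ) ^ k')) :
    W.torsionGaloisModuleReduceLE p h P = 0 ↔ ∃ Q : geomTorsion W ((p : ℤ) ^ k'), P = ((p : ℤ) ^ k) • Q := by
  constructor
  · intro h0
    have hP : (p : ℤ) ^ (k' - k) • (P : geomPoints W) = 0 := by
      rw [← W.coe_torsionGaloisModuleReduceLE p h P, h0]
      rfl
    obtain ⟨Q₀, hQ₀⟩ := W.zsmul_geomPoints_surjective_holds (n := (p : ℤ) ^ k)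
      (pow_ne_zero k (by exact_mod_cast hp.out.ne_zero)) (P : geomPoints W)
    change ((p : ℤ) ^ k) • Q₀ = (P : geomPoints W) at hQ₀
    have hpow : ((p : ℤ) ^ k') = (p : ℤ) ^ (k' - k) * (p : ℤ) ^ k := by
      rw [← pow_add, Nat.sub_add_cancel h]
    have hQ₀mem : Q₀ ∈ geomTorsion W ((p : ℤ) ^ k') := by
      rw [mem_geomTorsion_iff, hpow, ← smul_smul, hQ₀, hP]
    refine ⟨⟨Q₀, hQ₀mem⟩, Subtype.ext ?_⟩
    rw [AddSubgroupClass.coe_zsmul]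
    exact hQ₀.symm
  · rintro ⟨Q, rfl⟩
    apply Subtype.ext
    rw [coe_torsionGaloisModuleReduceLE, ZeroMemClass.coe_zero, AddSubgroupClass.coe_zsmul, smul_smul, ← pow_add,
      Nat.sub_add_cancel h]
    exact (mem_geomTorsion_iff W _ _).mp Q.2

end WeierstrassCurve

/-! ## §2 The datum of the curve -/

namespace WeierstrassCurve

open Literature.NumberTheory.EllipticCurves Literature.NumberTheory.GaloisRepresentations
open Literature.NumberTheory.EllipticCurves.ZpExtension (EisensteinLevel)
open Literature.NumberTheory.GaloisCohomology.Howard2004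

variable {K : Type} [Field K] [NumberField K] (E : WeierstrassCurve K) [E.IsElliptic] {p : ℕ} [hp : Fact p.Prime]
  (κ : Literature.NumberTheory.EllipticCurves.ZpExtension K p) {m : ℕ} (hm : 1 ≤ m)

/-- The levels `E[p^k] ⊗ A_{m,k}` are free over `A_{m,k}` (H.0; tree `free_twisted_geomTorsion`), in the
`EisensteinLevel` spelling. [cite: Howard2004HeegnerKolyvagin, H.0 (arXiv p. 7 L57)] [cite: SilvermanAEC2009, Cor. III.6.4(b)] -/
theorem free_eisensteinLevel_geomTorsion (k : ℕ) :
    Module.Free (IwasawaAlgebra.EisensteinCoeff p m k) (EisensteinLevel p m (fun j ↦ geomTorsion E ((p : ℤ) ^ j)) k) :=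
  E.free_twisted_geomTorsion (p := p) (m := m) (by exact_mod_cast hp.out.ne_zero) k

/-- **The `π`-adic refinement datum of the curve's Eisenstein tower** `k ↦ E[p^k] ⊗ A_{m,k}(ψ)` over `S_𝔮`
(`ZpExtension.eisensteinPiRefinementDatum` with `M_k = E[p^k]`, transitions `P ↦ p^{k'-k} P`).
[cite: Howard2004HeegnerKolyvagin, §1.6 (arXiv p. 12 L29–55), §2.2 and proof of Thm. 2.2.10 (𝔮 = T^m + p)] -/
def eisensteinPiRefinementDatum :
    PiRefinementDatum K (IwasawaAlgebra p ⧸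
        Ideal.span {(PowerSeries.X ^ m + PowerSeries.C (p : ℤ_[p]) : IwasawaAlgebra p)})
      (EisensteinLevel p m (fun j ↦ geomTorsion E ((p : ℤ) ^ j))) :=
  κ.eisensteinPiRefinementDatum (fun j ↦ E.torsionGaloisModule ((p : ℤ) ^ j))
    (fun _ _ h ↦ E.torsionGaloisModuleReduceLE p h) hm
    (fun k P ↦ E.torsionGaloisModuleReduceLE_refl p k P)
    (fun _ _ _ h₁ h₂ P ↦ E.torsionGaloisModuleReduceLE_trans p h₁ h₂ P)
    (fun _ _ h ↦ E.torsionGaloisModuleReduceLE_surjective p h)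
    (fun _ _ h P ↦ E.torsionGaloisModuleReduceLE_eq_zero_iff p h P)
    (fun k ↦ E.free_eisensteinLevel_geomTorsion (p := p) (m := m) k)

/-- The levels of the curve's datum. [cite: Howard2004HeegnerKolyvagin, §2.2] -/
theorem eisensteinPiRefinementDatum_ρ (k : ℕ) :
    (E.eisensteinPiRefinementDatum κ hm).ρ k =
      (κ.eisensteinTwist (E.torsionGaloisModule ((p : ℤ) ^ k)) hm k :
        ContinuousRep (absoluteGaloisGroup K) ℤ (EisensteinLevel p m (fun j ↦ geomTorsion E ((p : ℤ) ^ j)) k)) :=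
  rfl

/-- The reductions of the curve's datum. [cite: Howard2004HeegnerKolyvagin, §2.2] -/
theorem eisensteinPiRefinementDatum_red_apply {k k' : ℕ} (h : k ≤ k')
    (x : EisensteinLevel p m (fun j ↦ geomTorsion E ((p : ℤ) ^ j)) k') :
    (E.eisensteinPiRefinementDatum κ hm).red h x =
      κ.eisensteinTwistReduce hm h (E.torsionGaloisModuleReduceLE p h)
        (x : IwasawaAlgebra.EisensteinCoeff.Twisted p m k' (geomTorsion E ((p : ℤ) ^ k'))) :=
  rfl

/-- **The one-step reductions of the datum are those of the (shifted) Eisenstein tower of the §1.6 assembly**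
(`eisensteinAdicTowerSucc` along `torsionGaloisModuleReduce`): same `eisensteinTwistReduce`, the two-index transition
at `k ≤ k+1` being `P ↦ p • P`. [cite: Howard2004HeegnerKolyvagin, §1.6 and §2.2] -/
theorem eisensteinPiRefinementDatum_red_succ (k : ℕ)
    (x : EisensteinLevel p m (fun j ↦ geomTorsion E ((p : ℤ) ^ j)) (k + 1)) :
    (E.eisensteinPiRefinementDatum κ hm).red (Nat.le_succ k) x =
      κ.eisensteinTwistReduce hm (Nat.le_succ k) (E.torsionGaloisModuleReduce p k)
        (x : IwasawaAlgebra.EisensteinCoeff.Twisted p m (k + 1) (geomTorsion E ((p : ℤ) ^ (k + 1)))) := by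
  rw [eisensteinPiRefinementDatum_red_apply, torsionGaloisModuleReduceLE_succ]

/-- `π`, `e`, `host` of the curve's datum. [cite: Howard2004HeegnerKolyvagin, proof of Thm. 2.2.10] -/
theorem eisensteinPiRefinementDatum_e (k : ℕ) : (E.eisensteinPiRefinementDatum κ hm).e k = m * k := rfl

/-- `π = T mod 𝔮` for the curve's datum. [cite: Howard2004HeegnerKolyvagin, proof of Thm. 2.2.10] -/
theorem eisensteinPiRefinementDatum_π :
    (E.eisensteinPiRefinementDatum κ hm).π = Ideal.Quotient.mk _ PowerSeries.X := rfl

/-- `host i = ⌈i/m⌉` for the curve's datum. [cite: Howard2004HeegnerKolyvagin, proof of Thm. 2.2.10] -/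
theorem eisensteinPiRefinementDatum_host (i : ℕ) : (E.eisensteinPiRefinementDatum κ hm).host i = (i + m - 1) / m := rfl

/-- `host (m j) ≤ j` for the curve's datum. [cite: Howard2004HeegnerKolyvagin, §1.6 (arXiv p. 12 L29–55)] -/
theorem eisensteinPiRefinementDatum_host_mul_le (j : ℕ) : (E.eisensteinPiRefinementDatum κ hm).host (m * j) ≤ j :=
  (ZpExtension.ceilDiv_mul hm j).le

end WeierstrassCurve

end
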